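import Summits.CriticalPhenomena.PercolationContinuityZ3.Theorems.PercNearOneGluingNoHeavyLowerTailThreePartitionJuntaInsert
import HarnessLib.Audit

/-!
# `NoHeavyLowerTail` (crux stmt-CriticalPhenomena-4575), master-family hierarchy P3 (gen 38): the signature method is CLOSED UNDER
# CONJUNCTION WITH A NEW COIN — a pure diagonal certificate for `𝔘` on the block `Q` extends to one for `𝔘 ∧ x` on `insert x Q` (either twist of `x`)

Support file (seat `prim-masterthm-p3`; `--supports stmt-CriticalPhenomena-4575`; memo
`run/shared/lean/prim/prim-masterthm/FROM-prim-masterthm-p3-g38-PDC-STRUCTURE.md` §3).  Let `κ` be a pure diagonal certificate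
(`DiagCert τ Q 𝔘 κ`, file `…ThreePartitionJuntaCert`) for an up-set `𝔘` of Q-parts and let `x ∉ Q`.  With `𝔘 ∧ x := andVar x 𝔘`
(so `liftQ (insert x Q) (𝔘 ∧ x) = liftQ Q 𝔘 ∩ {S : x ∈ S}`, file `…ThreePartitionJuntaInsert`) and the weights
`andKappa τ x κ m = [x ∈ m]·w·κ(m \ {x})`, `w = 2` if `x ∈ τ`, `w = 1` otherwise:
THEOREM `DiagCert.andVar`: `andKappa τ x κ` is a pure diagonal certificate for `𝔘 ∧ x` on `insert x Q` at the twist `τ`.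
Proof.  A signature `𝔄` of the bigger block enters through the nested pair `𝔄 ⊆ secVar x 𝔄`; after the bookkeeping of `…JuntaInsert`
(`sum_cJ_insert_*`, `sum_eJ_insert_*`, `sum_andKappa_insert`), condition (ii) for the new weights is (ii) for `κ` at the outer sections plus
monotonicity, and condition (i) is (i) for `κ` at the outer sections plus the two block Kleitman inequalities `sum_cfgsIn_ind_le₁₂/₁₃`
(file `…ThreePartitionJuntaBlockKleitman`) applied with the (non-monotone) difference families `secVar x 𝔅 \ 𝔅`, `secVar x 𝔄 \ 𝔄` on the free copy.
Numerically: the rule `κ ⊗ (0, w)` extends all 291 certified classes with `|Q| ≤ 4` at both twists of `x` (exact check, gen 38).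
COROLLARY `threePartNT_liftQ_and_nonneg_of_certs`: certificates for `𝔘` at all twists of `Q` give `N_τ(liftQ Q 𝔘 ∩ {x ∈ ·}; A, B) ≥ 0`
for all up-sets `A, B`, every `τ` (iterated over finitely many new coins in `…ThreePartitionJuntaAndVars`).  HONEST LABEL: a closure property
of the certificate method; the general conjecture (COMB-C3) stays OPEN. [this work]
-/

noncomputable section

open Finset
open scoped symmDiff Classical

namespace Summit.CriticalPhenomena.PercolationContinuityZ3.Theorems.ThreePartition

variable {ι : Type*} [Fintype ι]

/-! ## Indicator arithmetic -/

section IndZ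

omit [Fintype ι]

/-- `indZ` is monotone along implications. [this work] -/
theorem indZ_le_indZ_of_imp {p q : Prop} (h : p → q) : indZ p ≤ indZ q := by
  unfold indZ; by_cases hp : p
  · rw [if_pos hp, if_pos (h hp)]
  · rw [if_neg hp]; split_ifs <;> norm_num

/-- Splitting an indicator along a nested pair `b → b'`: `[p]·([a ∧ b'] − [a ∧ b]) = [p ∧ a ∧ b' ∧ ¬b]`. [this work] -/
theorem indZ_mul_sub_of_imp (p a : Prop) {b b' : Prop} (h : b → b') :
    indZ p * (indZ (a ∧ b') - indZ (a ∧ b)) = indZ (p ∧ a ∧ (b' ∧ ¬ b)) := by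
  unfold indZ
  by_cases hp : p
  · by_cases ha : a
    · by_cases hb : b
      · rw [if_pos hp, if_pos ⟨ha, h hb⟩, if_pos ⟨ha, hb⟩, if_neg (fun h' : p ∧ a ∧ (b' ∧ ¬ b) => h'.2.2.2 hb)]; ring
      · by_cases hb' : b'
        · rw [if_pos hp, if_pos ⟨ha, hb'⟩, if_neg (fun h' : a ∧ b => hb h'.2), if_pos ⟨hp, ha, hb', hb⟩]; ring
        · rw [if_pos hp, if_neg (fun h' : a ∧ b' => hb' h'.2), if_neg (fun h' : a ∧ b => hb h'.2),
            if_neg (fun h' : p ∧ a ∧ (b' ∧ ¬ b) => hb' h'.2.2.1)]; ring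
    · rw [if_neg (fun h' : a ∧ b' => ha h'.1), if_neg (fun h' : a ∧ b => ha h'.1), if_neg (fun h' : p ∧ a ∧ (b' ∧ ¬ b) => ha h'.2.1)]
      ring
  · rw [if_neg hp, if_neg (fun h' : p ∧ a ∧ (b' ∧ ¬ b) => hp h'.1)]; ring

end IndZ

/-! ## The two junta forms of `𝔘 ∧ x` on `insert x Q`, as pattern sums over `Q` -/

section Forms

variable (τ : Set ι) {Q : Set ι} {x : ι} (𝔘 : Set (Set ι))

/-- The two-copy form of `𝔘 ∧ x`, `x` untwisted. [this work] -/
theorem sum_cJ_insert_of_notMem (hx : x ∉ Q) (hxτ : x ∉ τ) (𝔄 𝔅 : Set (Set ι)) :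
    ∑ P ∈ cfgsIn (insert x Q), cJ τ (insert x Q) (andVar x 𝔘) P * indZ (qc₂ τ (insert x Q) P ∈ 𝔄 ∧ qc₃ τ (insert x Q) P ∈ 𝔅)
      = ∑ P ∈ cfgsIn Q, (indZ (qc₂ τ Q P ∈ 𝔘) * indZ (qc₂ τ Q P ∈ secVar x 𝔄 ∧ qc₃ τ Q P ∈ 𝔅)
          + indZ (qc₃ τ Q P ∈ 𝔘) * indZ (qc₂ τ Q P ∈ 𝔄 ∧ qc₃ τ Q P ∈ secVar x 𝔅)
          - indZ (qc₁ τ Q P ∈ 𝔘) * indZ (qc₂ τ Q P ∈ 𝔄 ∧ qc₃ τ Q P ∈ 𝔅)) := by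
  rw [sum_cfgsIn_insert hx]
  refine sum_congr rfl fun P hP => ?_
  have hP' := mem_cfgsIn.1 hP
  have n1 : x ∉ qc₁ τ Q P := fun h => hx (qc₁_subset (τ := τ) hP'.1 h)
  have n2 : x ∉ qc₂ τ Q P := fun h => hx (qc₂_subset (τ := τ) hP'.2.1 h)
  have n3 : x ∉ qc₃ τ Q P := fun h => hx (qc₃_subset τ Q P h)
  obtain ⟨a1, a2, a3⟩ := qc_ins₁ τ hx hP
  obtain ⟨b1, b2, b3⟩ := qc_ins₂ τ hx hP
  obtain ⟨c1, c2, c3⟩ := qc_ins₃ τ hx hP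
  rw [if_neg hxτ] at a1 a2 a3 b1 b2 b3 c1 c2 c3
  unfold cJ
  rw [a1, a2, a3, b1, b2, b3, c1, c2, c3, indZ_of_neg (not_mem_andVar n2), indZ_of_neg (not_mem_andVar n3), indZ_of_neg (not_mem_andVar n1),
    indZ_congr (insert_mem_andVar_iff n1), indZ_congr (insert_mem_andVar_iff n2), indZ_congr (insert_mem_andVar_iff n3)]
  simp only [mem_secVar]
  ring

/-- The two-copy form of `𝔘 ∧ x`, `x` twisted. [this work] -/
theorem sum_cJ_insert_of_mem (hx : x ∉ Q) (hxτ : x ∈ τ) (𝔄 𝔅 : Set (Set ι)) :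
    ∑ P ∈ cfgsIn (insert x Q), cJ τ (insert x Q) (andVar x 𝔘) P * indZ (qc₂ τ (insert x Q) P ∈ 𝔄 ∧ qc₃ τ (insert x Q) P ∈ 𝔅)
      = ∑ P ∈ cfgsIn Q, ((indZ (qc₂ τ Q P ∈ 𝔘) + indZ (qc₃ τ Q P ∈ 𝔘)) * indZ (qc₂ τ Q P ∈ secVar x 𝔄 ∧ qc₃ τ Q P ∈ secVar x 𝔅)
          + (indZ (qc₃ τ Q P ∈ 𝔘) - indZ (qc₁ τ Q P ∈ 𝔘)) * indZ (qc₂ τ Q P ∈ 𝔄 ∧ qc₃ τ Q P ∈ secVar x 𝔅)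
          + (indZ (qc₂ τ Q P ∈ 𝔘) - indZ (qc₁ τ Q P ∈ 𝔘)) * indZ (qc₂ τ Q P ∈ secVar x 𝔄 ∧ qc₃ τ Q P ∈ 𝔅)) := by
  rw [sum_cfgsIn_insert hx]
  refine sum_congr rfl fun P hP => ?_
  have hP' := mem_cfgsIn.1 hP
  have n1 : x ∉ qc₁ τ Q P := fun h => hx (qc₁_subset (τ := τ) hP'.1 h)
  have n2 : x ∉ qc₂ τ Q P := fun h => hx (qc₂_subset (τ := τ) hP'.2.1 h)
  have n3 : x ∉ qc₃ τ Q P := fun h => hx (qc₃_subset τ Q P h)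
  obtain ⟨a1, a2, a3⟩ := qc_ins₁ τ hx hP
  obtain ⟨b1, b2, b3⟩ := qc_ins₂ τ hx hP
  obtain ⟨c1, c2, c3⟩ := qc_ins₃ τ hx hP
  rw [if_pos hxτ] at a1 a2 a3 b1 b2 b3 c1 c2 c3
  unfold cJ
  rw [a1, a2, a3, b1, b2, b3, c1, c2, c3, indZ_of_neg (not_mem_andVar n2), indZ_of_neg (not_mem_andVar n3), indZ_of_neg (not_mem_andVar n1),
    indZ_congr (insert_mem_andVar_iff n1), indZ_congr (insert_mem_andVar_iff n2), indZ_congr (insert_mem_andVar_iff n3)]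
  simp only [mem_secVar]
  ring

/-- The one-copy form of `𝔘 ∧ x`, `x` untwisted. [this work] -/
theorem sum_eJ_insert_of_notMem (hx : x ∉ Q) (hxτ : x ∉ τ) (𝔄 𝔅 : Set (Set ι)) :
    ∑ P ∈ cfgsIn (insert x Q), eJ τ (insert x Q) (andVar x 𝔘) P * indZ (qc₃ τ (insert x Q) P ∈ 𝔄 ∧ qc₃ τ (insert x Q) P ∈ 𝔅)
      = ∑ P ∈ cfgsIn Q, (2 * indZ (qc₃ τ Q P ∈ 𝔘) * indZ (qc₃ τ Q P ∈ secVar x 𝔄 ∧ qc₃ τ Q P ∈ secVar x 𝔅)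
          - indZ (qc₁ τ Q P ∈ 𝔘) * indZ (qc₃ τ Q P ∈ 𝔄 ∧ qc₃ τ Q P ∈ 𝔅)) := by
  rw [sum_cfgsIn_insert hx]
  refine sum_congr rfl fun P hP => ?_
  have hP' := mem_cfgsIn.1 hP
  have n1 : x ∉ qc₁ τ Q P := fun h => hx (qc₁_subset (τ := τ) hP'.1 h)
  have n3 : x ∉ qc₃ τ Q P := fun h => hx (qc₃_subset τ Q P h)
  obtain ⟨a1, -, a3⟩ := qc_ins₁ τ hx hP
  obtain ⟨b1, -, b3⟩ := qc_ins₂ τ hx hP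
  obtain ⟨c1, -, c3⟩ := qc_ins₃ τ hx hP
  rw [if_neg hxτ] at a1 a3 b1 b3 c1 c3
  unfold eJ
  rw [a1, a3, b1, b3, c1, c3, indZ_of_neg (not_mem_andVar n3), indZ_of_neg (not_mem_andVar n1),
    indZ_congr (insert_mem_andVar_iff n1), indZ_congr (insert_mem_andVar_iff n3)]
  simp only [mem_secVar]
  ring

/-- The one-copy form of `𝔘 ∧ x`, `x` twisted. [this work] -/
theorem sum_eJ_insert_of_mem (hx : x ∉ Q) (hxτ : x ∈ τ) (𝔄 𝔅 : Set (Set ι)) :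
    ∑ P ∈ cfgsIn (insert x Q), eJ τ (insert x Q) (andVar x 𝔘) P * indZ (qc₃ τ (insert x Q) P ∈ 𝔄 ∧ qc₃ τ (insert x Q) P ∈ 𝔅)
      = ∑ P ∈ cfgsIn Q, ((4 * indZ (qc₃ τ Q P ∈ 𝔘) - indZ (qc₁ τ Q P ∈ 𝔘)) * indZ (qc₃ τ Q P ∈ secVar x 𝔄 ∧ qc₃ τ Q P ∈ secVar x 𝔅)
          - indZ (qc₁ τ Q P ∈ 𝔘) * indZ (qc₃ τ Q P ∈ 𝔄 ∧ qc₃ τ Q P ∈ 𝔅)) := by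
  rw [sum_cfgsIn_insert hx]
  refine sum_congr rfl fun P hP => ?_
  have hP' := mem_cfgsIn.1 hP
  have n1 : x ∉ qc₁ τ Q P := fun h => hx (qc₁_subset (τ := τ) hP'.1 h)
  have n3 : x ∉ qc₃ τ Q P := fun h => hx (qc₃_subset τ Q P h)
  obtain ⟨a1, -, a3⟩ := qc_ins₁ τ hx hP
  obtain ⟨b1, -, b3⟩ := qc_ins₂ τ hx hP
  obtain ⟨c1, -, c3⟩ := qc_ins₃ τ hx hP
  rw [if_pos hxτ] at a1 a3 b1 b3 c1 c3
  unfold eJ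
  rw [a1, a3, b1, b3, c1, c3, indZ_of_neg (not_mem_andVar n3), indZ_of_neg (not_mem_andVar n1),
    indZ_congr (insert_mem_andVar_iff n1), indZ_congr (insert_mem_andVar_iff n3)]
  simp only [mem_secVar]
  ring

/-- The extended weights: `[x ∈ m]·w·κ(m \ {x})`, `w = 2` if `x` is twisted, else `1`. [this work] -/
def andKappa (τ : Set ι) (x : ι) (κ : Set ι → ℤ) (m : Set ι) : ℤ := if x ∈ m then (if x ∈ τ then 2 else 1) * κ (m \ {x}) else 0

/-- The diagonal form of the extended weights is `w` times the diagonal form of `κ` at the sections. [this work] -/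
theorem sum_andKappa_insert (hx : x ∉ Q) (κ : Set ι → ℤ) (𝔄 𝔅 : Set (Set ι)) :
    ∑ m ∈ subsetsOf (insert x Q), andKappa τ x κ m * indZ (m ∈ 𝔄 ∧ m ∈ 𝔅)
      = (if x ∈ τ then 2 else 1) * ∑ m ∈ subsetsOf Q, κ m * indZ (m ∈ secVar x 𝔄 ∧ m ∈ secVar x 𝔅) := by
  rw [sum_subsetsOf_insert hx, mul_sum]
  refine sum_congr rfl fun m hm => ?_
  have hxm : x ∉ m := fun h => hx (mem_subsetsOf.1 hm h)
  unfold andKappa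
  rw [if_pos (Set.mem_insert _ _), if_neg hxm, Set.insert_sdiff_self_of_notMem hxm, zero_mul, add_zero, mul_assoc]
  rfl

end Forms

/-! ## The theorem -/

section Main

variable {τ Q : Set ι} {𝔘 : Set (Set ι)} {κ : Set ι → ℤ} {x : ι}

/-- **Closure of pure diagonal certificates under conjunction with a new coin.** [this work] -/
theorem DiagCert.andVar (hc : DiagCert τ Q 𝔘 κ) (h𝔘 : IsUpperSet 𝔘) (hx : x ∉ Q) :
    DiagCert τ (insert x Q) (andVar x 𝔘) (andKappa τ x κ) := by
  refine ⟨fun m hm => ?_, fun 𝔄 𝔅 h𝔄 h𝔅 => ?_, fun 𝔄 𝔅 h𝔄 h𝔅 => ?_⟩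
  · -- nonnegativity
    unfold andKappa
    split_ifs with hxm
    · have hmQ : m \ {x} ⊆ Q := fun c hc => (Set.mem_insert_iff.1 (mem_subsetsOf.1 hm hc.1)).resolve_left hc.2
      have := hc.nonneg (m \ {x}) (mem_subsetsOf.2 hmQ)
      positivity
    · have hmQ : m \ {x} ⊆ Q := fun c hc => (Set.mem_insert_iff.1 (mem_subsetsOf.1 hm hc.1)).resolve_left hc.2
      have := hc.nonneg (m \ {x}) (mem_subsetsOf.2 hmQ)
      positivity
    · exact le_rfl
  · -- condition (i)
    have h𝔄' : IsUpperSet (secVar x 𝔄) := isUpperSet_secVar h𝔄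
    have h𝔅' : IsUpperSet (secVar x 𝔅) := isUpperSet_secVar h𝔅
    have hAA : ∀ m, m ∈ 𝔄 → m ∈ secVar x 𝔄 := fun m hm => mem_secVar_of_mem h𝔄 hm
    have hBB : ∀ m, m ∈ 𝔅 → m ∈ secVar x 𝔅 := fun m hm => mem_secVar_of_mem h𝔅 hm
    have hi := hc.two_le (secVar x 𝔄) (secVar x 𝔅) h𝔄' h𝔅'
    -- (i) for κ at the sections, expanded
    have hi' : ∑ P ∈ cfgsIn Q, cJ τ Q 𝔘 P * indZ (qc₂ τ Q P ∈ secVar x 𝔄 ∧ qc₃ τ Q P ∈ secVar x 𝔅)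
        = ∑ P ∈ cfgsIn Q, (indZ (qc₂ τ Q P ∈ 𝔘) * indZ (qc₂ τ Q P ∈ secVar x 𝔄 ∧ qc₃ τ Q P ∈ secVar x 𝔅)
          + indZ (qc₃ τ Q P ∈ 𝔘) * indZ (qc₂ τ Q P ∈ secVar x 𝔄 ∧ qc₃ τ Q P ∈ secVar x 𝔅)
          - indZ (qc₁ τ Q P ∈ 𝔘) * indZ (qc₂ τ Q P ∈ secVar x 𝔄 ∧ qc₃ τ Q P ∈ secVar x 𝔅)) :=
      sum_congr rfl fun P _ => by unfold cJ; ring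
    -- the four nested-pair splittings
    have sA : ∑ P ∈ cfgsIn Q, indZ (qc₁ τ Q P ∈ 𝔘) * indZ (qc₂ τ Q P ∈ secVar x 𝔄 ∧ qc₃ τ Q P ∈ secVar x 𝔅)
        - ∑ P ∈ cfgsIn Q, indZ (qc₁ τ Q P ∈ 𝔘) * indZ (qc₂ τ Q P ∈ secVar x 𝔄 ∧ qc₃ τ Q P ∈ 𝔅)
        = ∑ P ∈ cfgsIn Q, indZ (qc₁ τ Q P ∈ 𝔘 ∧ qc₂ τ Q P ∈ secVar x 𝔄 ∧ qc₃ τ Q P ∈ secVar x 𝔅 \ 𝔅) := by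
      rw [← sum_sub_distrib]
      exact sum_congr rfl fun P _ => by rw [← mul_sub, indZ_mul_sub_of_imp _ _ (hBB _)]; rfl
    have sB : ∑ P ∈ cfgsIn Q, indZ (qc₁ τ Q P ∈ 𝔘) * indZ (qc₂ τ Q P ∈ secVar x 𝔄 ∧ qc₃ τ Q P ∈ 𝔅)
        - ∑ P ∈ cfgsIn Q, indZ (qc₁ τ Q P ∈ 𝔘) * indZ (qc₂ τ Q P ∈ 𝔄 ∧ qc₃ τ Q P ∈ 𝔅)
        = ∑ P ∈ cfgsIn Q, indZ (qc₁ τ Q P ∈ 𝔘 ∧ qc₂ τ Q P ∈ secVar x 𝔄 \ 𝔄 ∧ qc₃ τ Q P ∈ 𝔅) := by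
      rw [← sum_sub_distrib]
      refine sum_congr rfl fun P _ => ?_
      rw [← mul_sub, indZ_congr (and_comm (a := qc₂ τ Q P ∈ secVar x 𝔄)), indZ_congr (and_comm (a := qc₂ τ Q P ∈ 𝔄)),
        indZ_mul_sub_of_imp _ _ (hAA _)]
      exact indZ_congr ⟨fun h => ⟨h.1, h.2.2, h.2.1⟩, fun h => ⟨h.1, h.2.2, h.2.1⟩⟩
    have sB' : ∑ P ∈ cfgsIn Q, indZ (qc₁ τ Q P ∈ 𝔘) * indZ (qc₂ τ Q P ∈ secVar x 𝔄 ∧ qc₃ τ Q P ∈ secVar x 𝔅)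
        - ∑ P ∈ cfgsIn Q, indZ (qc₁ τ Q P ∈ 𝔘) * indZ (qc₂ τ Q P ∈ 𝔄 ∧ qc₃ τ Q P ∈ secVar x 𝔅)
        = ∑ P ∈ cfgsIn Q, indZ (qc₁ τ Q P ∈ 𝔘 ∧ qc₂ τ Q P ∈ secVar x 𝔄 \ 𝔄 ∧ qc₃ τ Q P ∈ secVar x 𝔅) := by
      rw [← sum_sub_distrib]
      refine sum_congr rfl fun P _ => ?_
      rw [← mul_sub, indZ_congr (and_comm (a := qc₂ τ Q P ∈ secVar x 𝔄)), indZ_congr (and_comm (a := qc₂ τ Q P ∈ 𝔄)),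
        indZ_mul_sub_of_imp _ _ (hAA _)]
      exact indZ_congr ⟨fun h => ⟨h.1, h.2.2, h.2.1⟩, fun h => ⟨h.1, h.2.2, h.2.1⟩⟩
    have sC : ∑ P ∈ cfgsIn Q, indZ (qc₂ τ Q P ∈ 𝔘) * indZ (qc₂ τ Q P ∈ secVar x 𝔄 ∧ qc₃ τ Q P ∈ secVar x 𝔅)
        - ∑ P ∈ cfgsIn Q, indZ (qc₂ τ Q P ∈ 𝔘) * indZ (qc₂ τ Q P ∈ secVar x 𝔄 ∧ qc₃ τ Q P ∈ 𝔅)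
        = ∑ P ∈ cfgsIn Q, indZ (qc₂ τ Q P ∈ 𝔘 ∧ qc₂ τ Q P ∈ secVar x 𝔄 ∧ qc₃ τ Q P ∈ secVar x 𝔅 \ 𝔅) := by
      rw [← sum_sub_distrib]
      exact sum_congr rfl fun P _ => by rw [← mul_sub, indZ_mul_sub_of_imp _ _ (hBB _)]; rfl
    have sD : ∑ P ∈ cfgsIn Q, indZ (qc₃ τ Q P ∈ 𝔘) * indZ (qc₂ τ Q P ∈ secVar x 𝔄 ∧ qc₃ τ Q P ∈ secVar x 𝔅)
        - ∑ P ∈ cfgsIn Q, indZ (qc₃ τ Q P ∈ 𝔘) * indZ (qc₂ τ Q P ∈ 𝔄 ∧ qc₃ τ Q P ∈ secVar x 𝔅)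
        = ∑ P ∈ cfgsIn Q, indZ (qc₂ τ Q P ∈ secVar x 𝔄 \ 𝔄 ∧ qc₃ τ Q P ∈ 𝔘 ∧ qc₃ τ Q P ∈ secVar x 𝔅) := by
      rw [← sum_sub_distrib]
      refine sum_congr rfl fun P _ => ?_
      rw [← mul_sub, indZ_congr (and_comm (a := qc₂ τ Q P ∈ secVar x 𝔄)), indZ_congr (and_comm (a := qc₂ τ Q P ∈ 𝔄)),
        indZ_mul_sub_of_imp _ _ (hAA _)]
      exact indZ_congr ⟨fun h => ⟨h.2.2, h.1, h.2.1⟩, fun h => ⟨h.2.1, h.2.2, h.1⟩⟩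
    -- the two block Kleitman inequalities and one monotonicity
    have k2 := sum_cfgsIn_ind_le₁₂ τ Q h𝔘 h𝔄' (secVar x 𝔅 \ 𝔅)
    have k3 := sum_cfgsIn_ind_le₁₃ τ Q h𝔘 h𝔅 (secVar x 𝔄 \ 𝔄)
    have k3' := sum_cfgsIn_ind_le₁₃ τ Q h𝔘 h𝔅' (secVar x 𝔄 \ 𝔄)
    have mD : ∑ P ∈ cfgsIn Q, indZ (qc₂ τ Q P ∈ secVar x 𝔄 \ 𝔄 ∧ qc₃ τ Q P ∈ 𝔘 ∧ qc₃ τ Q P ∈ 𝔅)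
        ≤ ∑ P ∈ cfgsIn Q, indZ (qc₂ τ Q P ∈ secVar x 𝔄 \ 𝔄 ∧ qc₃ τ Q P ∈ 𝔘 ∧ qc₃ τ Q P ∈ secVar x 𝔅) :=
      sum_le_sum fun P _ => indZ_le_indZ_of_imp fun h => ⟨h.1, h.2.1, hBB _ h.2.2⟩
    rw [sum_andKappa_insert τ hx]
    by_cases hxτ : x ∈ τ
    · rw [sum_cJ_insert_of_mem τ 𝔘 hx hxτ, if_pos hxτ]
      have e : ∑ P ∈ cfgsIn Q, ((indZ (qc₂ τ Q P ∈ 𝔘) + indZ (qc₃ τ Q P ∈ 𝔘)) * indZ (qc₂ τ Q P ∈ secVar x 𝔄 ∧ qc₃ τ Q P ∈ secVar x 𝔅)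
          + (indZ (qc₃ τ Q P ∈ 𝔘) - indZ (qc₁ τ Q P ∈ 𝔘)) * indZ (qc₂ τ Q P ∈ 𝔄 ∧ qc₃ τ Q P ∈ secVar x 𝔅)
          + (indZ (qc₂ τ Q P ∈ 𝔘) - indZ (qc₁ τ Q P ∈ 𝔘)) * indZ (qc₂ τ Q P ∈ secVar x 𝔄 ∧ qc₃ τ Q P ∈ 𝔅))
          = ∑ P ∈ cfgsIn Q, indZ (qc₂ τ Q P ∈ 𝔘) * indZ (qc₂ τ Q P ∈ secVar x 𝔄 ∧ qc₃ τ Q P ∈ secVar x 𝔅)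
            + ∑ P ∈ cfgsIn Q, indZ (qc₃ τ Q P ∈ 𝔘) * indZ (qc₂ τ Q P ∈ secVar x 𝔄 ∧ qc₃ τ Q P ∈ secVar x 𝔅)
            + ∑ P ∈ cfgsIn Q, indZ (qc₃ τ Q P ∈ 𝔘) * indZ (qc₂ τ Q P ∈ 𝔄 ∧ qc₃ τ Q P ∈ secVar x 𝔅)
            - ∑ P ∈ cfgsIn Q, indZ (qc₁ τ Q P ∈ 𝔘) * indZ (qc₂ τ Q P ∈ 𝔄 ∧ qc₃ τ Q P ∈ secVar x 𝔅)
            + ∑ P ∈ cfgsIn Q, indZ (qc₂ τ Q P ∈ 𝔘) * indZ (qc₂ τ Q P ∈ secVar x 𝔄 ∧ qc₃ τ Q P ∈ 𝔅)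
            - ∑ P ∈ cfgsIn Q, indZ (qc₁ τ Q P ∈ 𝔘) * indZ (qc₂ τ Q P ∈ secVar x 𝔄 ∧ qc₃ τ Q P ∈ 𝔅) := by
        rw [← sum_add_distrib, ← sum_add_distrib, ← sum_sub_distrib, ← sum_add_distrib, ← sum_sub_distrib]
        exact sum_congr rfl fun P _ => by ring
      rw [e]
      rw [hi', sum_sub_distrib, sum_add_distrib] at hi
      linarith
    · rw [sum_cJ_insert_of_notMem τ 𝔘 hx hxτ, if_neg hxτ, one_mul]
      rw [sum_sub_distrib, sum_add_distrib]
      rw [hi', sum_sub_distrib, sum_add_distrib] at hi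
      linarith
  · -- condition (ii)
    have h𝔄' : IsUpperSet (secVar x 𝔄) := isUpperSet_secVar h𝔄
    have h𝔅' : IsUpperSet (secVar x 𝔅) := isUpperSet_secVar h𝔅
    have hii := hc.le_one (secVar x 𝔄) (secVar x 𝔅) h𝔄' h𝔅'
    have hii' : ∑ P ∈ cfgsIn Q, eJ τ Q 𝔘 P * indZ (qc₃ τ Q P ∈ secVar x 𝔄 ∧ qc₃ τ Q P ∈ secVar x 𝔅)
        = 2 * ∑ P ∈ cfgsIn Q, indZ (qc₃ τ Q P ∈ 𝔘) * indZ (qc₃ τ Q P ∈ secVar x 𝔄 ∧ qc₃ τ Q P ∈ secVar x 𝔅)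
          - ∑ P ∈ cfgsIn Q, indZ (qc₁ τ Q P ∈ 𝔘) * indZ (qc₃ τ Q P ∈ secVar x 𝔄 ∧ qc₃ τ Q P ∈ secVar x 𝔅) := by
      rw [mul_sum, ← sum_sub_distrib]; exact sum_congr rfl fun P _ => by unfold eJ; ring
    have mono : ∑ P ∈ cfgsIn Q, indZ (qc₁ τ Q P ∈ 𝔘) * indZ (qc₃ τ Q P ∈ 𝔄 ∧ qc₃ τ Q P ∈ 𝔅)
        ≤ ∑ P ∈ cfgsIn Q, indZ (qc₁ τ Q P ∈ 𝔘) * indZ (qc₃ τ Q P ∈ secVar x 𝔄 ∧ qc₃ τ Q P ∈ secVar x 𝔅) :=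
      sum_le_sum fun P _ => mul_le_mul_of_nonneg_left
        (indZ_le_indZ_of_imp fun h => ⟨mem_secVar_of_mem h𝔄 h.1, mem_secVar_of_mem h𝔅 h.2⟩) (indZ_nonneg _)
    rw [sum_andKappa_insert τ hx]
    by_cases hxτ : x ∈ τ
    · rw [sum_eJ_insert_of_mem τ 𝔘 hx hxτ, if_pos hxτ]
      have e : ∑ P ∈ cfgsIn Q, ((4 * indZ (qc₃ τ Q P ∈ 𝔘) - indZ (qc₁ τ Q P ∈ 𝔘)) * indZ (qc₃ τ Q P ∈ secVar x 𝔄 ∧ qc₃ τ Q P ∈ secVar x 𝔅)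
          - indZ (qc₁ τ Q P ∈ 𝔘) * indZ (qc₃ τ Q P ∈ 𝔄 ∧ qc₃ τ Q P ∈ 𝔅))
          = 4 * ∑ P ∈ cfgsIn Q, indZ (qc₃ τ Q P ∈ 𝔘) * indZ (qc₃ τ Q P ∈ secVar x 𝔄 ∧ qc₃ τ Q P ∈ secVar x 𝔅)
            - ∑ P ∈ cfgsIn Q, indZ (qc₁ τ Q P ∈ 𝔘) * indZ (qc₃ τ Q P ∈ secVar x 𝔄 ∧ qc₃ τ Q P ∈ secVar x 𝔅)
            - ∑ P ∈ cfgsIn Q, indZ (qc₁ τ Q P ∈ 𝔘) * indZ (qc₃ τ Q P ∈ 𝔄 ∧ qc₃ τ Q P ∈ 𝔅) := by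
        rw [mul_sum, ← sum_sub_distrib, ← sum_sub_distrib]; exact sum_congr rfl fun P _ => by ring
      rw [e]; rw [hii'] at hii; linarith
    · rw [sum_eJ_insert_of_notMem τ 𝔘 hx hxτ, if_neg hxτ, one_mul]
      have e : ∑ P ∈ cfgsIn Q, (2 * indZ (qc₃ τ Q P ∈ 𝔘) * indZ (qc₃ τ Q P ∈ secVar x 𝔄 ∧ qc₃ τ Q P ∈ secVar x 𝔅)
          - indZ (qc₁ τ Q P ∈ 𝔘) * indZ (qc₃ τ Q P ∈ 𝔄 ∧ qc₃ τ Q P ∈ 𝔅))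
          = 2 * ∑ P ∈ cfgsIn Q, indZ (qc₃ τ Q P ∈ 𝔘) * indZ (qc₃ τ Q P ∈ secVar x 𝔄 ∧ qc₃ τ Q P ∈ secVar x 𝔅)
            - ∑ P ∈ cfgsIn Q, indZ (qc₁ τ Q P ∈ 𝔘) * indZ (qc₃ τ Q P ∈ 𝔄 ∧ qc₃ τ Q P ∈ 𝔅) := by
        rw [mul_sum, ← sum_sub_distrib]; exact sum_congr rfl fun P _ => by ring
      rw [e]; rw [hii'] at hii; linarith

/-- **Positivity for a junta cut by one more coin**: certificates for `𝔘` at every twist of the block give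
`N_τ(liftQ Q 𝔘 ∩ {S : x ∈ S}; A, B) ≥ 0` for all up-sets `A, B` and every twist `τ` (`x ∉ Q`). [this work] -/
theorem threePartNT_liftQ_and_nonneg_of_certs (h𝔘 : IsUpperSet 𝔘) (hx : x ∉ Q) (κ : Set ι → Set ι → ℤ)
    (hcs : ∀ τ₀, τ₀ ⊆ Q → DiagCert τ₀ Q 𝔘 (κ τ₀)) (τ : Set ι) {A B : Set (Set ι)} (hA : IsUpperSet A) (hB : IsUpperSet B) :
    0 ≤ threePartNT τ (liftQ Q 𝔘 ∩ {S | x ∈ S}) A B := by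
  rw [← liftQ_insert_andVar hx]
  refine threePartNT_liftQ_nonneg_of_certs (fun τ₀ => andKappa τ₀ x (κ (τ₀ ∩ Q))) (fun τ₀ hτ₀ => ?_) τ hA hB
  have hc : DiagCert τ₀ Q 𝔘 (κ (τ₀ ∩ Q)) :=
    (hcs (τ₀ ∩ Q) Set.inter_subset_right).of_inter_eq (by rw [Set.inter_assoc, Set.inter_self])
  exact hc.andVar h𝔘 hx

end Main

end Summit.CriticalPhenomena.PercolationContinuityZ3.Theorems.ThreePartition

end
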